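import Literature.Analysis.FluidPDE.WeakL3CaloricExtension
import Literature.Analysis.FluidPDE.PressurePoisson
import Literature.Analysis.FluidPDE.HeatFlowLpClass
import Literature.Analysis.UnboundedOperators.HeatIteratedDerivBounds
import Literature.Analysis.UnboundedOperators.HeatKernelGradientSmoothing
import HarnessLib

/-!
# The field `∇ div e^{σΔ} g` of a bounded `Lᵖ` vector field: semigroup identities and bounds

Analysis/FluidPDE support file (theorems only: no definition, no named fact, no `sorry`) on the
discharge path of `Literature.Analysis.FluidPDE.AlbrittonBarker2019_liouville_weakL3_backward`
(Albritton–Barker 2019, Thm. 4.1), step "initial layer of bounded mild solutions with weak-`L³`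
data" (Barker–Seregin–Šverák, arXiv:1603.03211, Lemma 3.4). The layer is proved by the global
energy method of loc. cit. for the remainder `w = v − e^{tΔ}ḡ − G̃(t)`, where `u₀ = ḡ + g̃` is
the truncation of the datum at height `N` (`|ḡ| ≤ N`, `g̃ ∈ L²`) and
`G̃(t) = ∫_{σ > t} ∇ div e^{σΔ} ḡ dσ` is the gradient corrector making `e^{tΔ}g̃ − G̃(t)`
divergence free (a heat-subordinated form of the Leray projection of the splitting of
loc. cit., Lemma 2.1). This file supplies the calculus of the integrand
`I(σ) = ∇ div e^{σΔ} g` for a bounded, a.e. strongly measurable `Lᵖ` field `g`: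

* `norm_divergence_le_traceCLM`, `norm_fderiv_divergence_le_traceCLM` — the divergence through the
  trace map `traceCLM`; `divergence_heatExtension_of_bounded`, `gradient_heatExtension_of_bounded` —
  `div` and `∇` fall on bounded `C¹` data (from `fderiv_heatExtension_of_bounded`);
* `heatExtension_bounds_of_bound` — all-order sup bounds of `e^{aΔ}g`;
* `divergence_heatExtension_semigroup`, `gradDiv_heatExtension_semigroup` — for `0 < a`, `0 < τ`,
  `div e^{(a+τ)Δ}g = e^{τΔ}(div e^{aΔ}g)` and `∇div e^{(a+τ)Δ}g = e^{τΔ}(∇div e^{aΔ}g)`;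
* sup and `Lᵖ` bounds: `norm_divergence_heatExtension_le`, `eLpNorm_divergence_heatExtension_le`,
  `norm_gradDiv_heatExtension_le` (`‖∇div e^{σΔ}g‖_∞ ≤ C σ^{-1-d/(2p)} ‖g‖_p`),
  `norm_fderiv_gradDiv_heatExtension_le`, `eLpNorm_gradDiv_heatExtension_le`,
  `eLpNorm_fderiv_gradDiv_heatExtension_le`;
* `hasDerivAt_divergence_heatExtension` — `∂_σ div e^{σΔ}g = Δ div e^{σΔ}g = div ∇div e^{σΔ}g`;
* `continuousOn_gradDiv_heatExtension_uncurry` — joint continuity on `(0,∞) × E`;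
* `gradDiv_heatExtension_eq_neg_of_isWeaklyDivFree_add` — `∇div e^{σΔ}g₁ = -∇div e^{σΔ}g₂` when
  `g₁ + g₂` is weakly divergence free.

## References

* T. Barker, G. Seregin, V. Šverák, *On stability of weak Navier–Stokes solutions with large
  `L^{3,∞}` initial data*, Comm. PDE 43 (2018) = arXiv:1603.03211, Lemma 2.1, Lemma 3.4.
  [`BarkerSeregin2016`]
* Y. Giga, M.-H. Giga, J. Saal, *Nonlinear PDEs* (2010), §1.1.3 (`Lᵖ–L^q` estimates for
  derivatives of the heat semigroup). [`GigaGigaSaal2010`]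
* P. G. Lemarié-Rieusset, *The Navier–Stokes Problem in the 21st Century* (2016), §6.2
  (derivatives commute with the heat kernel). [`LemarieRieusset2016`]
-/

noncomputable section

open MeasureTheory Set Function Filter Metric TopologicalSpace InnerProductSpace
open _root_.Topology
open scoped NNReal ENNReal Laplacian RealInnerProductSpace

namespace Literature.Analysis.FluidPDE

open UnboundedOperators

variable {E : Type*} [NormedAddCommGroup E] [InnerProductSpace ℝ E] [FiniteDimensional ℝ E]
  [MeasurableSpace E] [BorelSpace E]

/-! ### The divergence and the gradient as continuous linear maps of the derivative -/

omit [MeasurableSpace E] [BorelSpace E] in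
/-- `‖div v(x)‖ ≤ ‖tr‖ ‖Dv(x)‖` with `tr = traceCLM` the trace map. [folklore] -/
theorem norm_divergence_le_traceCLM (v : E → E) (x : E) :
    ‖VectorCalculus.divergence v x‖ ≤ ‖(traceCLM : (E →L[ℝ] E) →L[ℝ] ℝ)‖ * ‖fderiv ℝ v x‖ := by
  rw [divergence_eq_traceCLM]
  exact (traceCLM : (E →L[ℝ] E) →L[ℝ] ℝ).le_opNorm _

omit [MeasurableSpace E] [BorelSpace E] in
/-- The divergence of a `C¹` field is continuous. [folklore] -/
theorem continuous_divergence_of_contDiff {v : E → E} (hv : ContDiff ℝ 1 v) :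
    Continuous (VectorCalculus.divergence v) := by
  rw [divergence_eq_traceCLM_comp]
  exact (traceCLM : (E →L[ℝ] E) →L[ℝ] ℝ).continuous.comp (hv.continuous_fderiv one_ne_zero)

omit [MeasurableSpace E] [BorelSpace E] in
/-- The divergence of a `C^{n+1}` field is `Cⁿ`. [folklore] -/
theorem contDiff_divergence_of_contDiff_succ {v : E → E} {n : ℕ∞} (hv : ContDiff ℝ (n + 1) v) :
    ContDiff ℝ n (VectorCalculus.divergence v) := by
  rw [divergence_eq_traceCLM_comp]
  exact (traceCLM : (E →L[ℝ] E) →L[ℝ] ℝ).contDiff.comp (hv.fderiv_right (m := n) le_rfl)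

omit [MeasurableSpace E] [BorelSpace E] in
/-- The derivative of the divergence: `D(div v)(x) = L ∘ D²v(x)` with `L` the trace map, hence
`‖D(div v)(x)‖ ≤ ‖L‖ ‖D²v(x)‖`. [folklore] -/
theorem norm_fderiv_divergence_le_traceCLM {v : E → E} (hv : ContDiff ℝ 2 v) (x : E) :
    ‖fderiv ℝ (VectorCalculus.divergence v) x‖ ≤
      ‖(traceCLM : (E →L[ℝ] E) →L[ℝ] ℝ)‖ * ‖fderiv ℝ (fderiv ℝ v) x‖ := by
  have h : VectorCalculus.divergence v = fun x => (traceCLM : (E →L[ℝ] E) →L[ℝ] ℝ) (fderiv ℝ v x) :=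
    funext (divergence_eq_traceCLM v)
  have hd : DifferentiableAt ℝ (fderiv ℝ v) x :=
    ((hv.fderiv_right (m := 1) le_rfl).differentiable one_ne_zero) x
  have hcomp : HasFDerivAt (fun x => (traceCLM : (E →L[ℝ] E) →L[ℝ] ℝ) (fderiv ℝ v x))
      ((traceCLM : (E →L[ℝ] E) →L[ℝ] ℝ).comp (fderiv ℝ (fderiv ℝ v) x)) x :=
    (traceCLM : (E →L[ℝ] E) →L[ℝ] ℝ).hasFDerivAt.comp x hd.hasFDerivAt
  rw [h, hcomp.fderiv]
  exact ContinuousLinearMap.opNorm_comp_le _ _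

omit [MeasurableSpace E] [BorelSpace E] in
/-- `‖∇φ(x)‖ = ‖Dφ(x)‖`. [folklore] -/
theorem norm_gradient_eq_norm_fderiv' (φ : E → ℝ) (x : E) : ‖gradient φ x‖ = ‖fderiv ℝ φ x‖ := by
  rw [gradient, LinearIsometryEquiv.norm_map]

omit [MeasurableSpace E] [BorelSpace E] in
/-- `‖D(∇φ)(x)‖ ≤ ‖D²φ(x)‖` (the gradient is an isometric image of the derivative). [folklore] -/
theorem norm_fderiv_gradient_le {φ : E → ℝ} (x : E) :
    ‖fderiv ℝ (gradient φ) x‖ ≤ ‖fderiv ℝ (fderiv ℝ φ) x‖ := by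
  have hgrad : gradient φ = (InnerProductSpace.toDual ℝ E).symm ∘ (fderiv ℝ φ) := by
    funext z; rfl
  rw [hgrad, LinearIsometryEquiv.comp_fderiv]
  refine ContinuousLinearMap.opNorm_le_bound _ (norm_nonneg (fderiv ℝ (fderiv ℝ φ) x)) fun v => ?_
  rw [ContinuousLinearMap.comp_apply]
  calc ‖((InnerProductSpace.toDual ℝ E).symm : StrongDual ℝ E →L[ℝ] E) (fderiv ℝ (fderiv ℝ φ) x v)‖
      = ‖fderiv ℝ (fderiv ℝ φ) x v‖ := LinearIsometryEquiv.norm_map _ _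
    _ ≤ ‖fderiv ℝ (fderiv ℝ φ) x‖ * ‖v‖ := ContinuousLinearMap.le_opNorm _ _

/-! ### `div` and `∇` fall on bounded `C¹` data -/

/-- **The divergence falls on bounded `C¹` data**: `div (e^{tΔ}h) = e^{tΔ}(div h)` for
`h ∈ C¹` with `h`, `Dh` bounded (Lemarié-Rieusset 2016, §6.2). [cite: LemarieRieusset2016, §6.2] -/
theorem divergence_heatExtension_of_bounded {h : E → E} (hh : ContDiff ℝ 1 h) {C₀ C₁ : ℝ}
    (h0 : ∀ z, ‖h z‖ ≤ C₀) (h1 : ∀ z, ‖fderiv ℝ h z‖ ≤ C₁) {t : ℝ} (ht : 0 < t) (x : E) :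
    VectorCalculus.divergence (heatExtension h t) x =
      heatExtension (VectorCalculus.divergence h) t x := by
  haveI : CompleteSpace E := FiniteDimensional.complete ℝ E
  have hdiv : VectorCalculus.divergence h = fun z => (traceCLM : (E →L[ℝ] E) →L[ℝ] ℝ) (fderiv ℝ h z) :=
    funext (divergence_eq_traceCLM h)
  rw [divergence_eq_traceCLM, fderiv_heatExtension_of_bounded hh h0 h1 ht x, hdiv,
    heatExtension_clm_comp_of_bound _ (hh.continuous_fderiv one_ne_zero) h1 ht x]

/-- **The gradient falls on bounded `C¹` data**: `∇(e^{tΔ}φ) = e^{tΔ}(∇φ)` for `φ ∈ C¹` with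
`φ`, `Dφ` bounded (Lemarié-Rieusset 2016, §6.2). [cite: LemarieRieusset2016, §6.2] -/
theorem gradient_heatExtension_of_bounded {φ : E → ℝ} (hφ : ContDiff ℝ 1 φ) {C₀ C₁ : ℝ}
    (h0 : ∀ z, ‖φ z‖ ≤ C₀) (h1 : ∀ z, ‖fderiv ℝ φ z‖ ≤ C₁) {t : ℝ} (ht : 0 < t) (x : E) :
    gradient (heatExtension φ t) x = heatExtension (gradient φ) t x := by
  haveI : CompleteSpace E := FiniteDimensional.complete ℝ E
  have hgrad : gradient φ = fun z =>
      ((InnerProductSpace.toDual ℝ E).symm : StrongDual ℝ E →L[ℝ] E) (fderiv ℝ φ z) := by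
    funext z; rfl
  rw [hgrad, heatExtension_clm_comp_of_bound _ (hφ.continuous_fderiv one_ne_zero) h1 ht x,
    ← fderiv_heatExtension_of_bounded hφ h0 h1 ht x]
  rfl

/-! ### Bounded `C^∞` data: the slices `e^{aΔ}g` of bounded measurable data -/

/-- **All-order bounds of the caloric extension of bounded measurable data**: for `g` a.e.
strongly measurable with `‖g‖ ≤ C` and `a > 0`, `e^{aΔ}g` is `C^∞` and every derivative is
bounded, `‖Dᵏ(e^{aΔ}g)(x)‖ ≤ B k` (Giga–Giga–Saal 2010, §1.1.3). [cite: GigaGigaSaal2010, §1.1.3] -/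
theorem heatExtension_bounds_of_bound {F : Type*} [NormedAddCommGroup F] [NormedSpace ℝ F]
    [CompleteSpace F] {g : E → F} (hgm : AEStronglyMeasurable g volume) {C : ℝ}
    (hC : ∀ z, ‖g z‖ ≤ C) {a : ℝ} (ha : 0 < a) :
    ContDiff ℝ (⊤ : ℕ∞) (heatExtension g a) ∧
      ∃ B : ℕ → ℝ, ∀ k (x : E), ‖iteratedFDeriv ℝ k (heatExtension g a) x‖ ≤ B k := by
  have hmem : MemLp g ∞ (volume : Measure E) := memLp_top_of_bound hgm C (Eventually.of_forall hC)
  refine ⟨contDiff_heatExtension_holds hmem le_top ha, ?_⟩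
  choose A hA0 hA using fun k => exists_norm_iteratedFDeriv_heatExtension_le (E := E) (F := F) k
  exact ⟨fun k => A k * a ^ (-(k : ℝ) / 2) * C, fun k x => hA k ha hgm hC x⟩

omit [FiniteDimensional ℝ E] [MeasurableSpace E] [BorelSpace E] in
/-- From all-order bounds: the bounds of orders `0, 1, 2` in the form used by the bounded-data
heat calculus. [folklore] -/
theorem bounds_zero_one_two {F : Type*} [NormedAddCommGroup F] [NormedSpace ℝ F] {h : E → F}
    {B : ℕ → ℝ} (hB : ∀ k (x : E), ‖iteratedFDeriv ℝ k h x‖ ≤ B k) :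
    (∀ z, ‖h z‖ ≤ B 0) ∧ (∀ z, ‖fderiv ℝ h z‖ ≤ B 1) ∧ (∀ z, ‖fderiv ℝ (fderiv ℝ h) z‖ ≤ B 2) := by
  refine ⟨fun z => ?_, fun z => ?_, fun z => ?_⟩
  · have h0 := hB 0 z
    rwa [norm_iteratedFDeriv_zero] at h0
  · have h1 := hB 1 z
    rwa [norm_iteratedFDeriv_one] at h1
  · have h2 := hB 2 z
    have e : ‖fderiv ℝ (fderiv ℝ h) z‖ = ‖iteratedFDeriv ℝ 2 h z‖ := by
      rw [← norm_iteratedFDeriv_one, norm_iteratedFDeriv_fderiv]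
    rwa [← e] at h2

omit [MeasurableSpace E] [BorelSpace E] in
/-- **The `C^∞`-with-bounded-derivatives class is preserved**: if `h` is `C²` with `h, Dh, D²h`
bounded and continuous then so are `div h` (`C¹`, bounded with bounded derivative) — the form
needed to let `∇` fall on `div (e^{aΔ}g)`. [folklore] -/
theorem divergence_bounds_of_bounds {h : E → E} (hh : ContDiff ℝ 2 h) {B : ℕ → ℝ}
    (hB : ∀ k (x : E), ‖iteratedFDeriv ℝ k h x‖ ≤ B k) :
    ∃ D₀ D₁ : ℝ, (∀ z, ‖VectorCalculus.divergence h z‖ ≤ D₀) ∧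
      (∀ z, ‖fderiv ℝ (VectorCalculus.divergence h) z‖ ≤ D₁) := by
  obtain ⟨-, h1, h2⟩ := bounds_zero_one_two hB
  have hT : 0 ≤ ‖(traceCLM : (E →L[ℝ] E) →L[ℝ] ℝ)‖ := ContinuousLinearMap.opNorm_nonneg _
  exact ⟨‖(traceCLM : (E →L[ℝ] E) →L[ℝ] ℝ)‖ * B 1, ‖(traceCLM : (E →L[ℝ] E) →L[ℝ] ℝ)‖ * B 2,
    fun z => (norm_divergence_le_traceCLM h z).trans (mul_le_mul_of_nonneg_left (h1 z) hT),
    fun z => (norm_fderiv_divergence_le_traceCLM hh z).trans (mul_le_mul_of_nonneg_left (h2 z) hT)⟩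

/-! ### Semigroup identities for `div e^{σΔ}g` and `∇div e^{σΔ}g` -/

section Semigroup

variable {g : E → E} {p : ℝ≥0∞}

/-- **`div e^{(a+τ)Δ}g = e^{τΔ}(div e^{aΔ}g)`** for bounded measurable `Lᵖ` data `g`, `0 < a`,
`0 < τ` (semigroup law `e^{(a+τ)Δ} = e^{τΔ}e^{aΔ}` and the divergence falls on the bounded smooth
slice `e^{aΔ}g`; Lemarié-Rieusset 2016, §6.2). [cite: LemarieRieusset2016, §6.2] -/
theorem divergence_heatExtension_semigroup (hgm : AEStronglyMeasurable g volume) {K : ℝ}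
    (hK : ∀ z, ‖g z‖ ≤ K) {a τ : ℝ} (ha : 0 < a) (hτ : 0 < τ) (x : E) :
    VectorCalculus.divergence (heatExtension g (a + τ)) x =
      heatExtension (VectorCalculus.divergence (heatExtension g a)) τ x := by
  haveI : CompleteSpace E := FiniteDimensional.complete ℝ E
  have hmem : MemLp g ∞ (volume : Measure E) := memLp_top_of_bound hgm K (Eventually.of_forall hK)
  obtain ⟨hsm, B, hB⟩ := heatExtension_bounds_of_bound hgm hK ha
  obtain ⟨h0, h1, -⟩ := bounds_zero_one_two hB
  rw [← heatExtension_add_holds hmem le_top ha hτ]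
  exact divergence_heatExtension_of_bounded (contDiff_infty.1 hsm 1) h0 h1 hτ x

/-- **`∇div e^{(a+τ)Δ}g = e^{τΔ}(∇div e^{aΔ}g)`** for bounded measurable `Lᵖ` data `g`, `0 < a`,
`0 < τ`. [cite: LemarieRieusset2016, §6.2] -/
theorem gradDiv_heatExtension_semigroup (hgm : AEStronglyMeasurable g volume) {K : ℝ}
    (hK : ∀ z, ‖g z‖ ≤ K) {a τ : ℝ} (ha : 0 < a) (hτ : 0 < τ) (x : E) :
    gradient (VectorCalculus.divergence (heatExtension g (a + τ))) x =
      heatExtension (gradient (VectorCalculus.divergence (heatExtension g a))) τ x := by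
  haveI : CompleteSpace E := FiniteDimensional.complete ℝ E
  obtain ⟨hsm, B, hB⟩ := heatExtension_bounds_of_bound hgm hK ha
  have hsm2 : ContDiff ℝ 2 (heatExtension g a) := contDiff_infty.1 hsm 2
  obtain ⟨D₀, D₁, hD₀, hD₁⟩ := divergence_bounds_of_bounds hsm2 hB
  have hd1 : ContDiff ℝ 1 (VectorCalculus.divergence (heatExtension g a)) :=
    contDiff_divergence_of_contDiff_succ (n := 1) (contDiff_infty.1 hsm 2)
  have hfun : VectorCalculus.divergence (heatExtension g (a + τ)) =
      heatExtension (VectorCalculus.divergence (heatExtension g a)) τ :=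
    funext fun y => divergence_heatExtension_semigroup hgm hK ha hτ y
  rw [hfun]
  exact gradient_heatExtension_of_bounded hd1 hD₀ hD₁ hτ x

/-- **Regularity of `div e^{σΔ}g` and `∇div e^{σΔ}g`**: for `σ > 0` both are `C^∞` with all
derivatives bounded (each is a caloric extension at time `σ/2` of bounded continuous data).
[folklore] -/
theorem gradDiv_heatExtension_smooth (hgm : AEStronglyMeasurable g volume) {K : ℝ}
    (hK : ∀ z, ‖g z‖ ≤ K) {σ : ℝ} (hσ : 0 < σ) :
    ContDiff ℝ (⊤ : ℕ∞) (VectorCalculus.divergence (heatExtension g σ)) ∧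
    ContDiff ℝ (⊤ : ℕ∞) (gradient (VectorCalculus.divergence (heatExtension g σ))) ∧
    (∃ D : ℕ → ℝ, ∀ k (x : E),
      ‖iteratedFDeriv ℝ k (VectorCalculus.divergence (heatExtension g σ)) x‖ ≤ D k) ∧
    (∃ D : ℕ → ℝ, ∀ k (x : E),
      ‖iteratedFDeriv ℝ k (gradient (VectorCalculus.divergence (heatExtension g σ))) x‖ ≤ D k) := by
  haveI : CompleteSpace E := FiniteDimensional.complete ℝ E
  have ha : 0 < σ / 2 := by positivity
  have heq : σ = σ / 2 + σ / 2 := by ring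
  obtain ⟨hsm, B, hB⟩ := heatExtension_bounds_of_bound hgm hK ha
  have hsm2 : ContDiff ℝ 2 (heatExtension g (σ / 2)) := contDiff_infty.1 hsm 2
  obtain ⟨D₀, D₁, hD₀, hD₁⟩ := divergence_bounds_of_bounds hsm2 hB
  have hd1 : ContDiff ℝ 1 (VectorCalculus.divergence (heatExtension g (σ / 2))) :=
    contDiff_divergence_of_contDiff_succ (n := 1) (contDiff_infty.1 hsm 2)
  -- `div e^{σΔ}g` is the caloric extension of the bounded continuous `div e^{(σ/2)Δ}g`
  have hfun_d : VectorCalculus.divergence (heatExtension g σ) =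
      heatExtension (VectorCalculus.divergence (heatExtension g (σ / 2))) (σ / 2) := by
    funext y; conv_lhs => rw [heq]
    exact divergence_heatExtension_semigroup hgm hK ha ha y
  have hfun_I : gradient (VectorCalculus.divergence (heatExtension g σ)) =
      heatExtension (gradient (VectorCalculus.divergence (heatExtension g (σ / 2)))) (σ / 2) := by
    funext y; conv_lhs => rw [heq]
    exact gradDiv_heatExtension_semigroup hgm hK ha ha y
  have hdc : Continuous (VectorCalculus.divergence (heatExtension g (σ / 2))) := hd1.continuous
  have hIc : Continuous (gradient (VectorCalculus.divergence (heatExtension g (σ / 2)))) :=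
    ((InnerProductSpace.toDual ℝ E).symm.contDiff.comp (hd1.fderiv_right (m := 0) le_rfl)).continuous
  have hIb : ∀ z, ‖gradient (VectorCalculus.divergence (heatExtension g (σ / 2))) z‖ ≤ D₁ := fun z => by
    rw [norm_gradient_eq_norm_fderiv']; exact hD₁ z
  obtain ⟨hsd, Bd, hBd⟩ := heatExtension_bounds_of_bound hdc.aestronglyMeasurable hD₀ ha
  obtain ⟨hsI, BI, hBI⟩ := heatExtension_bounds_of_bound hIc.aestronglyMeasurable hIb ha
  rw [hfun_I, hfun_d]
  exact ⟨hsd, hsI, ⟨Bd, hBd⟩, ⟨BI, hBI⟩⟩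

end Semigroup

/-! ### Sup and `Lᵖ` bounds -/

section Bounds

variable {g : E → E} {p : ℝ≥0∞}

/-- **Sup bound of `div e^{σΔ}g`**: with `L` the trace map and the gradient smoothing constant
`C` of `exists_eLpNorm_fderiv_heatExtension_le_rpow` (`Lᵖ → L^∞`),
`‖div e^{σΔ}g (x)‖ ≤ ‖L‖ C σ^{-(1/2 + d/(2p))} ‖g‖_p` (Giga–Giga–Saal 2010, §1.1.3). [cite: GigaGigaSaal2010, §1.1.3] -/
theorem norm_divergence_heatExtension_le (hp : 1 ≤ p) :
    ∃ C : ℝ, 0 ≤ C ∧ ∀ (g : E → E), MemLp g p volume → ∀ σ : ℝ, 0 < σ → ∀ x,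
      ‖VectorCalculus.divergence (heatExtension g σ) x‖ ≤
        C * σ ^ (-(1 / 2 + (Module.finrank ℝ E : ℝ) / 2 * (1 / p).toReal)) *
          (eLpNorm g p volume).toReal := by
  haveI : CompleteSpace E := FiniteDimensional.complete ℝ E
  set L : (E →L[ℝ] E) →L[ℝ] ℝ := traceCLM with hLdef
  obtain ⟨C, hC⟩ := exists_eLpNorm_fderiv_heatExtension_le_rpow (E := E) (F := E) hp le_top
  refine ⟨‖L‖ * C, by positivity, fun g hg σ hσ x => ?_⟩
  have hsm : ContDiff ℝ (⊤ : ℕ∞) (heatExtension g σ) := contDiff_heatExtension_holds hg hp hσ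
  have hcont : Continuous (fderiv ℝ (heatExtension g σ)) := hsm.continuous_fderiv (by simp)
  have h1 := hC g hg σ hσ
  simp only [one_div, ENNReal.inv_top, ENNReal.toReal_zero, sub_zero] at h1
  rcases eq_or_ne (eLpNorm g p volume) ∞ with htop | htop
  · -- junk case: `‖g‖_p = ∞` is excluded by `MemLp`
    exact absurd htop hg.eLpNorm_ne_top
  have hfin : (C : ℝ≥0∞) * ENNReal.ofReal (σ ^ (-(2⁻¹ + (Module.finrank ℝ E : ℝ) / 2 * p⁻¹.toReal))) *
      eLpNorm g p volume ≠ ∞ :=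
    ENNReal.mul_ne_top (ENNReal.mul_ne_top ENNReal.coe_ne_top ENNReal.ofReal_ne_top) htop
  have h2 := norm_le_of_eLpNorm_top_le_of_continuous hcont hfin h1 x
  rw [ENNReal.toReal_mul, ENNReal.toReal_mul, ENNReal.coe_toReal,
    ENNReal.toReal_ofReal (Real.rpow_nonneg hσ.le _)] at h2
  calc ‖VectorCalculus.divergence (heatExtension g σ) x‖
      ≤ ‖L‖ * ‖fderiv ℝ (heatExtension g σ) x‖ := norm_divergence_le_traceCLM _ x
    _ ≤ ‖L‖ * (C * σ ^ (-(2⁻¹ + (Module.finrank ℝ E : ℝ) / 2 * p⁻¹.toReal)) * (eLpNorm g p volume).toReal) :=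
        mul_le_mul_of_nonneg_left h2 (norm_nonneg L)
    _ = ‖L‖ * C * σ ^ (-(1 / 2 + (Module.finrank ℝ E : ℝ) / 2 * (1 / p).toReal)) *
          (eLpNorm g p volume).toReal := by
        simp only [one_div]; ring

/-- **`Lᵖ` bound of `div e^{aΔ}g`**: `‖div e^{aΔ}g‖_p ≤ ‖L‖ C a^{-1/2} ‖g‖_p` and
`div e^{aΔ}g ∈ Lᵖ` (Giga–Giga–Saal 2010, §1.1.3). [cite: GigaGigaSaal2010, §1.1.3] -/
theorem eLpNorm_divergence_heatExtension_le (hp : 1 ≤ p) :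
    ∃ C : ℝ≥0, ∀ (g : E → E), MemLp g p volume → ∀ a : ℝ, 0 < a →
      MemLp (VectorCalculus.divergence (heatExtension g a)) p volume ∧
      eLpNorm (VectorCalculus.divergence (heatExtension g a)) p volume ≤
        C * ENNReal.ofReal (a ^ (-(1 / 2 : ℝ))) * eLpNorm g p volume := by
  haveI : CompleteSpace E := FiniteDimensional.complete ℝ E
  set L : (E →L[ℝ] E) →L[ℝ] ℝ := traceCLM with hLdef
  obtain ⟨C, hC⟩ := eLpNorm_fderiv_heatExtension_le_holds (E := E) (F := E) hp
  refine ⟨‖L‖₊ * C, fun g hg a ha => ?_⟩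
  have hsm : ContDiff ℝ (⊤ : ℕ∞) (heatExtension g a) := contDiff_heatExtension_holds hg hp ha
  have hcont : Continuous (VectorCalculus.divergence (heatExtension g a)) :=
    continuous_divergence_of_contDiff (contDiff_infty.1 hsm 1)
  -- pointwise domination by `‖L‖ ‖D e^{aΔ}g‖`
  have hdom : ∀ᵐ x ∂(volume : Measure E), ‖VectorCalculus.divergence (heatExtension g a) x‖ ≤
      ‖L‖ * ‖fderiv ℝ (heatExtension g a) x‖ :=
    Eventually.of_forall fun x => norm_divergence_le_traceCLM _ x
  have hle : eLpNorm (VectorCalculus.divergence (heatExtension g a)) p volume ≤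
      ENNReal.ofReal ‖L‖ * eLpNorm (fderiv ℝ (heatExtension g a)) p volume :=
    eLpNorm_le_mul_eLpNorm_of_ae_le_mul hdom p
  rw [show ENNReal.ofReal ‖L‖ = ((‖L‖₊ : ℝ≥0) : ℝ≥0∞) from
    (ENNReal.ofReal_eq_coe_nnreal (norm_nonneg L)).trans rfl] at hle
  have hfd : eLpNorm (fderiv ℝ (heatExtension g a)) p volume < ∞ :=
    lt_of_le_of_lt (hC g hg a ha) (ENNReal.mul_lt_top (ENNReal.mul_lt_top ENNReal.coe_lt_top
      ENNReal.ofReal_lt_top) hg.eLpNorm_lt_top)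
  refine ⟨⟨hcont.aestronglyMeasurable, lt_of_le_of_lt hle (ENNReal.mul_lt_top ENNReal.coe_lt_top hfd)⟩,
    hle.trans ?_⟩
  rw [ENNReal.coe_mul, mul_assoc, mul_assoc]
  exact mul_le_mul' le_rfl (by simpa [mul_assoc] using hC g hg a ha)

/-- **Sup bound of `∇div e^{σΔ}g`**: for bounded measurable `g ∈ Lᵖ` and `σ > 0`,
`‖∇div e^{σΔ}g (x)‖ ≤ C σ^{-(1 + d/(2p))} ‖g‖_p` (write `∇div e^{σΔ}g = ∇e^{(σ/2)Δ}(div e^{(σ/2)Δ}g)`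
and use the `Lᵖ → L^∞` gradient smoothing bound and the `Lᵖ` bound of `div e^{(σ/2)Δ}g`;
Giga–Giga–Saal 2010, §1.1.3). [cite: GigaGigaSaal2010, §1.1.3] -/
theorem norm_gradDiv_heatExtension_le (hp : 1 ≤ p) :
    ∃ C : ℝ, 0 ≤ C ∧ ∀ (g : E → E), MemLp g p volume → ∀ K : ℝ, (∀ z, ‖g z‖ ≤ K) →
      ∀ σ : ℝ, 0 < σ → ∀ x,
      ‖gradient (VectorCalculus.divergence (heatExtension g σ)) x‖ ≤
        C * σ ^ (-(1 + (Module.finrank ℝ E : ℝ) / 2 * (1 / p).toReal)) *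
          (eLpNorm g p volume).toReal := by
  haveI : CompleteSpace E := FiniteDimensional.complete ℝ E
  obtain ⟨C₁, hC₁⟩ := eLpNorm_divergence_heatExtension_le (E := E) (p := p) hp
  obtain ⟨C₂, hC₂⟩ := exists_eLpNorm_fderiv_heatExtension_le_rpow (E := E) (F := ℝ) hp le_top
  set θ : ℝ := (Module.finrank ℝ E : ℝ) / 2 * (1 / p).toReal with hθ
  have hθ0 : 0 ≤ θ := by positivity
  refine ⟨C₂ * C₁ * (2 : ℝ) ^ ((1 / 2 + θ) + 1 / 2), by positivity, fun g hg K hK σ hσ x => ?_⟩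
  have ha : 0 < σ / 2 := by positivity
  have heq : σ = σ / 2 + σ / 2 := by ring
  -- the bounded smooth slice `d = div e^{(σ/2)Δ}g ∈ Lᵖ`
  obtain ⟨hdmem, hdle⟩ := hC₁ g hg (σ / 2) ha
  obtain ⟨hsm, B, hB⟩ := heatExtension_bounds_of_bound hg.1 hK ha
  obtain ⟨D₀, D₁, hD₀, hD₁⟩ := divergence_bounds_of_bounds (contDiff_infty.1 hsm 2) hB
  have hd1 : ContDiff ℝ 1 (VectorCalculus.divergence (heatExtension g (σ / 2))) :=
    contDiff_divergence_of_contDiff_succ (n := 1) (contDiff_infty.1 hsm 2)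
  -- `∇div e^{σΔ}g = ∇ e^{(σ/2)Δ} d`
  have hI : gradient (VectorCalculus.divergence (heatExtension g σ)) x =
      gradient (heatExtension (VectorCalculus.divergence (heatExtension g (σ / 2))) (σ / 2)) x := by
    conv_lhs => rw [heq]
    rw [gradDiv_heatExtension_semigroup hg.1 hK ha ha x, gradient_heatExtension_of_bounded hd1 hD₀ hD₁ ha x]
  -- sup bound of `∇ e^{(σ/2)Δ} d` from the `Lᵖ → L^∞` smoothing bound
  have h1 := hC₂ _ hdmem (σ / 2) ha
  simp only [one_div, ENNReal.inv_top, ENNReal.toReal_zero, sub_zero] at h1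
  have hsm' : ContDiff ℝ (⊤ : ℕ∞) (heatExtension (VectorCalculus.divergence (heatExtension g (σ / 2))) (σ / 2)) :=
    contDiff_heatExtension_holds hdmem hp ha
  have hcont : Continuous (fderiv ℝ (heatExtension (VectorCalculus.divergence (heatExtension g (σ / 2))) (σ / 2))) :=
    hsm'.continuous_fderiv (by simp)
  have hgtop : eLpNorm g p volume ≠ ∞ := hg.eLpNorm_ne_top
  have hdtop : eLpNorm (VectorCalculus.divergence (heatExtension g (σ / 2))) p volume ≠ ∞ := hdmem.eLpNorm_ne_top
  have hfin : (C₂ : ℝ≥0∞) * ENNReal.ofReal ((σ / 2) ^ (-(2⁻¹ + (Module.finrank ℝ E : ℝ) / 2 * p⁻¹.toReal))) *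
      eLpNorm (VectorCalculus.divergence (heatExtension g (σ / 2))) p volume ≠ ∞ :=
    ENNReal.mul_ne_top (ENNReal.mul_ne_top ENNReal.coe_ne_top ENNReal.ofReal_ne_top) hdtop
  have h2 := norm_le_of_eLpNorm_top_le_of_continuous hcont hfin h1 x
  rw [ENNReal.toReal_mul, ENNReal.toReal_mul, ENNReal.coe_toReal,
    ENNReal.toReal_ofReal (Real.rpow_nonneg ha.le _)] at h2
  -- `‖d‖_p ≤ C₁ (σ/2)^{-1/2} ‖g‖_p` in real form
  have h3 : (eLpNorm (VectorCalculus.divergence (heatExtension g (σ / 2))) p volume).toReal ≤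
      C₁ * (σ / 2) ^ (-(1 / 2 : ℝ)) * (eLpNorm g p volume).toReal := by
    have h := ENNReal.toReal_mono (ENNReal.mul_ne_top (ENNReal.mul_ne_top ENNReal.coe_ne_top
      ENNReal.ofReal_ne_top) hgtop) hdle
    rwa [ENNReal.toReal_mul, ENNReal.toReal_mul, ENNReal.coe_toReal,
      ENNReal.toReal_ofReal (Real.rpow_nonneg ha.le _)] at h
  have hθ' : -(2⁻¹ + (Module.finrank ℝ E : ℝ) / 2 * p⁻¹.toReal) = -(1 / 2 + θ) := by
    rw [hθ]; simp only [one_div]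
  rw [hθ'] at h2
  have hpow : (σ / 2) ^ (-(1 / 2 + θ)) * (σ / 2) ^ (-(1 / 2 : ℝ)) =
      (2 : ℝ) ^ ((1 / 2 + θ) + 1 / 2) * σ ^ (-((1 / 2 + θ) + 1 / 2)) :=
    half_rpow_neg_mul_half_rpow_neg hσ _ _
  have hexp : -((1 / 2 + θ) + 1 / 2) = -(1 + θ) := by ring
  rw [hexp] at hpow
  rw [hI, norm_gradient_eq_norm_fderiv']
  calc ‖fderiv ℝ (heatExtension (VectorCalculus.divergence (heatExtension g (σ / 2))) (σ / 2)) x‖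
      ≤ C₂ * (σ / 2) ^ (-(1 / 2 + θ)) *
          (eLpNorm (VectorCalculus.divergence (heatExtension g (σ / 2))) p volume).toReal := h2
    _ ≤ C₂ * (σ / 2) ^ (-(1 / 2 + θ)) * (C₁ * (σ / 2) ^ (-(1 / 2 : ℝ)) * (eLpNorm g p volume).toReal) :=
        mul_le_mul_of_nonneg_left h3 (by positivity)
    _ = C₂ * C₁ * ((σ / 2) ^ (-(1 / 2 + θ)) * (σ / 2) ^ (-(1 / 2 : ℝ))) * (eLpNorm g p volume).toReal := by
        ring
    _ = C₂ * C₁ * (2 : ℝ) ^ ((1 / 2 + θ) + 1 / 2) * σ ^ (-(1 + θ)) * (eLpNorm g p volume).toReal := by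
        rw [hpow]; ring

/-- **Sup bound of `D ∇div e^{σΔ}g`**: `‖D(∇div e^{σΔ}g)(x)‖ ≤ C σ^{-(3/2 + d/(2p))} ‖g‖_p`
(`∇div e^{σΔ}g = e^{(σ/2)Δ}(∇div e^{(σ/2)Δ}g)` and the bounded-data gradient bound
`‖D e^{τΔ}h‖_∞ ≤ 2^{d/2} τ^{-1/2} ‖h‖_∞`; Giga–Giga–Saal 2010, §1.1.3). [cite: GigaGigaSaal2010, §1.1.3] -/
theorem norm_fderiv_gradDiv_heatExtension_le (hp : 1 ≤ p) :
    ∃ C : ℝ, 0 ≤ C ∧ ∀ (g : E → E), MemLp g p volume → ∀ K : ℝ, (∀ z, ‖g z‖ ≤ K) →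
      ∀ σ : ℝ, 0 < σ → ∀ x,
      ‖fderiv ℝ (gradient (VectorCalculus.divergence (heatExtension g σ))) x‖ ≤
        C * σ ^ (-(3 / 2 + (Module.finrank ℝ E : ℝ) / 2 * (1 / p).toReal)) *
          (eLpNorm g p volume).toReal := by
  haveI : CompleteSpace E := FiniteDimensional.complete ℝ E
  obtain ⟨C₁, hC₁0, hC₁⟩ := norm_gradDiv_heatExtension_le (E := E) (p := p) hp
  set θ : ℝ := (Module.finrank ℝ E : ℝ) / 2 * (1 / p).toReal with hθ
  have hθ0 : 0 ≤ θ := by positivity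
  refine ⟨(2 : ℝ) ^ ((Module.finrank ℝ E : ℝ) / 2) * C₁ * (2 : ℝ) ^ (1 / 2 + (1 + θ)), by positivity,
    fun g hg K hK σ hσ x => ?_⟩
  have ha : 0 < σ / 2 := by positivity
  have heq : σ = σ / 2 + σ / 2 := by ring
  -- `I(σ) = e^{(σ/2)Δ} I(σ/2)` with `I(σ/2)` continuous and bounded by `C₁ (σ/2)^{-(1+θ)} ‖g‖_p`
  have hIfun : gradient (VectorCalculus.divergence (heatExtension g σ)) =
      heatExtension (gradient (VectorCalculus.divergence (heatExtension g (σ / 2)))) (σ / 2) := by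
    funext y; conv_lhs => rw [heq]
    exact gradDiv_heatExtension_semigroup hg.1 hK ha ha y
  obtain ⟨-, hsI, -, -⟩ := gradDiv_heatExtension_smooth hg.1 hK ha
  have hIb : ∀ z, ‖gradient (VectorCalculus.divergence (heatExtension g (σ / 2))) z‖ ≤
      C₁ * (σ / 2) ^ (-(1 + θ)) * (eLpNorm g p volume).toReal := fun z => hC₁ g hg K hK (σ / 2) ha z
  have h1 := norm_fderiv_heatExtension_le_of_bounded (hsI.continuous.aestronglyMeasurable) hIb ha x
  have hpow : (σ / 2) ^ (-(1 / 2 : ℝ)) * (σ / 2) ^ (-(1 + θ)) =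
      (2 : ℝ) ^ (1 / 2 + (1 + θ)) * σ ^ (-(1 / 2 + (1 + θ))) :=
    half_rpow_neg_mul_half_rpow_neg hσ _ _
  have hexp : -(1 / 2 + (1 + θ)) = -(3 / 2 + θ) := by ring
  rw [hexp] at hpow
  rw [hIfun]
  calc ‖fderiv ℝ (heatExtension (gradient (VectorCalculus.divergence (heatExtension g (σ / 2)))) (σ / 2)) x‖
      ≤ (2 : ℝ) ^ ((Module.finrank ℝ E : ℝ) / 2) * (σ / 2) ^ (-(1 / 2 : ℝ)) *
          (C₁ * (σ / 2) ^ (-(1 + θ)) * (eLpNorm g p volume).toReal) := h1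
    _ = (2 : ℝ) ^ ((Module.finrank ℝ E : ℝ) / 2) * C₁ * ((σ / 2) ^ (-(1 / 2 : ℝ)) * (σ / 2) ^ (-(1 + θ))) *
          (eLpNorm g p volume).toReal := by ring
    _ = (2 : ℝ) ^ ((Module.finrank ℝ E : ℝ) / 2) * C₁ * (2 : ℝ) ^ (1 / 2 + (1 + θ)) * σ ^ (-(3 / 2 + θ)) *
          (eLpNorm g p volume).toReal := by rw [hpow]; ring

/-- **`L^q` bound of `∇div e^{σΔ}g`** (`p ≤ q`): `∇div e^{σΔ}g ∈ L^q` and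
`‖∇div e^{σΔ}g‖_q ≤ C σ^{-(1 + (d/2)(1/p - 1/q))} ‖g‖_p` (`Lᵖ → L^q` gradient smoothing bound on
`d = div e^{(σ/2)Δ}g` and `‖d‖_p ≤ C (σ/2)^{-1/2} ‖g‖_p`; Giga–Giga–Saal 2010, §1.1.3). [cite: GigaGigaSaal2010, §1.1.3] -/
theorem eLpNorm_gradDiv_heatExtension_le (hp : 1 ≤ p) {q : ℝ≥0∞} (hpq : p ≤ q) :
    ∃ C : ℝ≥0, ∀ (g : E → E), MemLp g p volume → ∀ K : ℝ, (∀ z, ‖g z‖ ≤ K) →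
      ∀ σ : ℝ, 0 < σ →
      MemLp (gradient (VectorCalculus.divergence (heatExtension g σ))) q volume ∧
      eLpNorm (gradient (VectorCalculus.divergence (heatExtension g σ))) q volume ≤
        C * ENNReal.ofReal (σ ^ (-(1 + (Module.finrank ℝ E : ℝ) / 2 * ((1 / p).toReal - (1 / q).toReal)))) *
          eLpNorm g p volume := by
  haveI : CompleteSpace E := FiniteDimensional.complete ℝ E
  obtain ⟨C₁, hC₁⟩ := eLpNorm_divergence_heatExtension_le (E := E) (p := p) hp
  obtain ⟨C₂, hC₂⟩ := exists_eLpNorm_fderiv_heatExtension_le_rpow (E := E) (F := ℝ) hp hpq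
  set θ : ℝ := (Module.finrank ℝ E : ℝ) / 2 * ((1 / p).toReal - (1 / q).toReal) with hθ
  have h2pos : (0 : ℝ) ≤ (2 : ℝ) ^ ((1 / 2 + θ) + 1 / 2) := by positivity
  refine ⟨C₂ * C₁ * NNReal.mk _ h2pos, fun g hg K hK σ hσ => ?_⟩
  have ha : 0 < σ / 2 := by positivity
  have heq : σ = σ / 2 + σ / 2 := by ring
  obtain ⟨hdmem, hdle⟩ := hC₁ g hg (σ / 2) ha
  obtain ⟨hsm, B, hB⟩ := heatExtension_bounds_of_bound hg.1 hK ha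
  obtain ⟨D₀, D₁, hD₀, hD₁⟩ := divergence_bounds_of_bounds (contDiff_infty.1 hsm 2) hB
  have hd1 : ContDiff ℝ 1 (VectorCalculus.divergence (heatExtension g (σ / 2))) :=
    contDiff_divergence_of_contDiff_succ (n := 1) (contDiff_infty.1 hsm 2)
  have hIfun : gradient (VectorCalculus.divergence (heatExtension g σ)) =
      gradient (heatExtension (VectorCalculus.divergence (heatExtension g (σ / 2))) (σ / 2)) := by
    funext y; conv_lhs => rw [heq]
    rw [gradDiv_heatExtension_semigroup hg.1 hK ha ha y, gradient_heatExtension_of_bounded hd1 hD₀ hD₁ ha y]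
  obtain ⟨-, hsI, -, -⟩ := gradDiv_heatExtension_smooth hg.1 hK hσ
  -- the `L^q` norms of `∇ e^{(σ/2)Δ}d` and `D e^{(σ/2)Δ}d` agree
  have hnormeq : eLpNorm (gradient (VectorCalculus.divergence (heatExtension g σ))) q volume =
      eLpNorm (fderiv ℝ (heatExtension (VectorCalculus.divergence (heatExtension g (σ / 2))) (σ / 2))) q volume := by
    rw [hIfun]
    exact eLpNorm_congr_norm_ae (Eventually.of_forall fun y => norm_gradient_eq_norm_fderiv' _ y)
  have hbound : eLpNorm (gradient (VectorCalculus.divergence (heatExtension g σ))) q volume ≤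
      (C₂ * C₁ * NNReal.mk _ h2pos : ℝ≥0) * ENNReal.ofReal (σ ^ (-(1 + θ))) * eLpNorm g p volume := by
    rw [hnormeq]
    have key : ENNReal.ofReal ((σ / 2) ^ (-(1 / 2 + θ))) * ENNReal.ofReal ((σ / 2) ^ (-(1 / 2 : ℝ))) =
        ENNReal.ofReal ((2 : ℝ) ^ ((1 / 2 + θ) + 1 / 2)) * ENNReal.ofReal (σ ^ (-(1 + θ))) := by
      rw [← ENNReal.ofReal_mul (Real.rpow_nonneg ha.le _), ← ENNReal.ofReal_mul h2pos,
        half_rpow_neg_mul_half_rpow_neg hσ, show -((1 / 2 + θ) + 1 / 2) = -(1 + θ) by ring]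
    calc eLpNorm (fderiv ℝ (heatExtension (VectorCalculus.divergence (heatExtension g (σ / 2))) (σ / 2))) q volume
        ≤ C₂ * ENNReal.ofReal ((σ / 2) ^ (-(1 / 2 + θ))) *
            eLpNorm (VectorCalculus.divergence (heatExtension g (σ / 2))) p volume := hC₂ _ hdmem (σ / 2) ha
      _ ≤ C₂ * ENNReal.ofReal ((σ / 2) ^ (-(1 / 2 + θ))) *
            (C₁ * ENNReal.ofReal ((σ / 2) ^ (-(1 / 2 : ℝ))) * eLpNorm g p volume) := by gcongr
      _ = C₂ * C₁ * (ENNReal.ofReal ((σ / 2) ^ (-(1 / 2 + θ))) * ENNReal.ofReal ((σ / 2) ^ (-(1 / 2 : ℝ)))) *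
            eLpNorm g p volume := by ring
      _ = (C₂ * C₁ * NNReal.mk _ h2pos : ℝ≥0) * ENNReal.ofReal (σ ^ (-(1 + θ))) * eLpNorm g p volume := by
          rw [key, ENNReal.coe_mul, ENNReal.coe_mul,
            show ((NNReal.mk _ h2pos : ℝ≥0) : ℝ≥0∞) = ENNReal.ofReal ((2 : ℝ) ^ ((1 / 2 + θ) + 1 / 2)) from
              (ENNReal.ofReal_eq_coe_nnreal h2pos).symm]
          ring
  refine ⟨⟨hsI.continuous.aestronglyMeasurable, hbound.trans_lt ?_⟩, hbound⟩
  exact ENNReal.mul_lt_top (ENNReal.mul_lt_top ENNReal.coe_lt_top ENNReal.ofReal_lt_top) hg.eLpNorm_lt_top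

/-- **`L^q` bound of `D ∇div e^{σΔ}g`** (`p ≤ q`): `‖D ∇div e^{σΔ}g‖_q ≤ C σ^{-(3/2 + (d/2)(1/p-1/q))} ‖g‖_p`
(gradient bound `‖D e^{τΔ}h‖_q ≤ C τ^{-1/2} ‖h‖_q` on `h = ∇div e^{(σ/2)Δ}g ∈ L^q`;
Giga–Giga–Saal 2010, §1.1.3). [cite: GigaGigaSaal2010, §1.1.3] -/
theorem eLpNorm_fderiv_gradDiv_heatExtension_le (hp : 1 ≤ p) {q : ℝ≥0∞} (hpq : p ≤ q) :
    ∃ C : ℝ≥0, ∀ (g : E → E), MemLp g p volume → ∀ K : ℝ, (∀ z, ‖g z‖ ≤ K) →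
      ∀ σ : ℝ, 0 < σ →
      eLpNorm (fderiv ℝ (gradient (VectorCalculus.divergence (heatExtension g σ)))) q volume ≤
        C * ENNReal.ofReal (σ ^ (-(3 / 2 + (Module.finrank ℝ E : ℝ) / 2 * ((1 / p).toReal - (1 / q).toReal)))) *
          eLpNorm g p volume := by
  haveI : CompleteSpace E := FiniteDimensional.complete ℝ E
  obtain ⟨C₁, hC₁⟩ := eLpNorm_gradDiv_heatExtension_le (E := E) (p := p) hp hpq
  obtain ⟨C₂, hC₂⟩ := eLpNorm_fderiv_heatExtension_le_holds (E := E) (F := E) (hp.trans hpq)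
  set θ : ℝ := (Module.finrank ℝ E : ℝ) / 2 * ((1 / p).toReal - (1 / q).toReal) with hθ
  have h2pos : (0 : ℝ) ≤ (2 : ℝ) ^ (1 / 2 + (1 + θ)) := by positivity
  refine ⟨C₂ * C₁ * NNReal.mk _ h2pos, fun g hg K hK σ hσ => ?_⟩
  have ha : 0 < σ / 2 := by positivity
  have heq : σ = σ / 2 + σ / 2 := by ring
  obtain ⟨hImem, hIle⟩ := hC₁ g hg K hK (σ / 2) ha
  have hIfun : gradient (VectorCalculus.divergence (heatExtension g σ)) =
      heatExtension (gradient (VectorCalculus.divergence (heatExtension g (σ / 2)))) (σ / 2) := by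
    funext y; conv_lhs => rw [heq]
    exact gradDiv_heatExtension_semigroup hg.1 hK ha ha y
  have key : ENNReal.ofReal ((σ / 2) ^ (-(1 / 2 : ℝ))) * ENNReal.ofReal ((σ / 2) ^ (-(1 + θ))) =
      ENNReal.ofReal ((2 : ℝ) ^ (1 / 2 + (1 + θ))) * ENNReal.ofReal (σ ^ (-(3 / 2 + θ))) := by
    rw [← ENNReal.ofReal_mul (Real.rpow_nonneg ha.le _), ← ENNReal.ofReal_mul h2pos,
      half_rpow_neg_mul_half_rpow_neg hσ, show -(1 / 2 + (1 + θ)) = -(3 / 2 + θ) by ring]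
  rw [hIfun]
  calc eLpNorm (fderiv ℝ (heatExtension (gradient (VectorCalculus.divergence (heatExtension g (σ / 2)))) (σ / 2))) q volume
      ≤ C₂ * ENNReal.ofReal ((σ / 2) ^ (-(1 / 2 : ℝ))) *
          eLpNorm (gradient (VectorCalculus.divergence (heatExtension g (σ / 2)))) q volume := hC₂ _ hImem (σ / 2) ha
    _ ≤ C₂ * ENNReal.ofReal ((σ / 2) ^ (-(1 / 2 : ℝ))) *
          (C₁ * ENNReal.ofReal ((σ / 2) ^ (-(1 + θ))) * eLpNorm g p volume) := by gcongr
    _ = C₂ * C₁ * (ENNReal.ofReal ((σ / 2) ^ (-(1 / 2 : ℝ))) * ENNReal.ofReal ((σ / 2) ^ (-(1 + θ)))) *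
          eLpNorm g p volume := by ring
    _ = (C₂ * C₁ * NNReal.mk _ h2pos : ℝ≥0) * ENNReal.ofReal (σ ^ (-(3 / 2 + θ))) * eLpNorm g p volume := by
        rw [key, ENNReal.coe_mul, ENNReal.coe_mul,
          show ((NNReal.mk _ h2pos : ℝ≥0) : ℝ≥0∞) = ENNReal.ofReal ((2 : ℝ) ^ (1 / 2 + (1 + θ))) from
            (ENNReal.ofReal_eq_coe_nnreal h2pos).symm]
        ring

end Bounds

/-! ### Time derivative and continuity -/

section Time

variable {g : E → E} {p : ℝ≥0∞}

/-- **Semigroup form on a half line**: for `0 < a < s`,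
`div e^{sΔ}g = e^{(s−a)Δ}(div e^{aΔ}g)` as functions. [cite: LemarieRieusset2016, §6.2] -/
theorem divergence_heatExtension_eq_of_lt (hgm : AEStronglyMeasurable g volume) {K : ℝ}
    (hK : ∀ z, ‖g z‖ ≤ K) {a s : ℝ} (ha : 0 < a) (has : a < s) :
    VectorCalculus.divergence (heatExtension g s) =
      heatExtension (VectorCalculus.divergence (heatExtension g a)) (s - a) := by
  funext y
  have h := divergence_heatExtension_semigroup hgm hK ha (sub_pos.2 has) y
  rwa [add_sub_cancel] at h

/-- The same for `∇div e^{sΔ}g`. [cite: LemarieRieusset2016, §6.2] -/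
theorem gradDiv_heatExtension_eq_of_lt (hgm : AEStronglyMeasurable g volume) {K : ℝ}
    (hK : ∀ z, ‖g z‖ ≤ K) {a s : ℝ} (ha : 0 < a) (has : a < s) :
    gradient (VectorCalculus.divergence (heatExtension g s)) =
      heatExtension (gradient (VectorCalculus.divergence (heatExtension g a))) (s - a) := by
  funext y
  have h := gradDiv_heatExtension_semigroup hgm hK ha (sub_pos.2 has) y
  rwa [add_sub_cancel] at h

/-- **Time derivative of `div e^{σΔ}g`**: `∂_σ div e^{σΔ}g (x) = Δ(div e^{σΔ}g)(x)` for `σ > 0`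
(`div e^{σΔ}g = e^{(σ−a)Δ}d` near `σ` with `d = div e^{aΔ}g ∈ Lᵖ`, `a = σ/2`, and the heat
equation for `Lᵖ` data; Folland 1995, Thm. 4.3). [cite: Folland1995PDE, §4.A Theorem (4.3)] -/
theorem hasDerivAt_divergence_heatExtension (hg : MemLp g p volume) (hp : 1 ≤ p) {K : ℝ}
    (hK : ∀ z, ‖g z‖ ≤ K) {σ : ℝ} (hσ : 0 < σ) (x : E) :
    HasDerivAt (fun s => VectorCalculus.divergence (heatExtension g s) x)
      ((Δ (VectorCalculus.divergence (heatExtension g σ))) x) σ := by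
  haveI : CompleteSpace E := FiniteDimensional.complete ℝ E
  have ha : 0 < σ / 2 := by positivity
  have haσ : σ / 2 < σ := by linarith
  obtain ⟨C₁, hC₁⟩ := eLpNorm_divergence_heatExtension_le (E := E) (p := p) hp
  obtain ⟨hdmem, -⟩ := hC₁ g hg (σ / 2) ha
  -- derivative of `s ↦ e^{(s - a)Δ} d (x)` at `σ`
  have h1 : HasDerivAt (fun τ => heatExtension (VectorCalculus.divergence (heatExtension g (σ / 2))) τ x)
      ((Δ (heatExtension (VectorCalculus.divergence (heatExtension g (σ / 2))) (σ - σ / 2))) x) (σ - σ / 2) :=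
    hasDerivAt_heatExtension_time (by linarith) hdmem hp x
  have h2 := h1.comp_sub_const σ (σ / 2)
  rw [← divergence_heatExtension_eq_of_lt hg.1 hK ha haσ] at h2
  refine h2.congr_of_eventuallyEq ?_
  filter_upwards [Ioi_mem_nhds haσ] with s hs
  exact congrFun (divergence_heatExtension_eq_of_lt hg.1 hK ha hs) x

/-- `Δ(div e^{σΔ}g) = div(∇div e^{σΔ}g)` (`div ∇ = Δ` on `C²` functions). [folklore] -/
theorem laplacian_divergence_heatExtension_eq (hgm : AEStronglyMeasurable g volume) {K : ℝ}
    (hK : ∀ z, ‖g z‖ ≤ K) {σ : ℝ} (hσ : 0 < σ) (x : E) :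
    (Δ (VectorCalculus.divergence (heatExtension g σ))) x =
      VectorCalculus.divergence (gradient (VectorCalculus.divergence (heatExtension g σ))) x := by
  obtain ⟨hsd, -, -, -⟩ := gradDiv_heatExtension_smooth hgm hK hσ
  exact (divergence_gradient (contDiff_infty.1 hsd 2) x).symm

/-- **Joint continuity of `(σ, x) ↦ ∇div e^{σΔ}g (x)` on `(0,∞) × E`** (locally it is the
caloric extension of bounded continuous data). [folklore] -/
theorem continuousOn_gradDiv_heatExtension_uncurry (hgm : AEStronglyMeasurable g volume) {K : ℝ}
    (hK : ∀ z, ‖g z‖ ≤ K) :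
    ContinuousOn (fun q : ℝ × E => gradient (VectorCalculus.divergence (heatExtension g q.1)) q.2)
      (Ioi (0 : ℝ) ×ˢ univ) := by
  haveI : CompleteSpace E := FiniteDimensional.complete ℝ E
  refine continuousOn_of_forall_continuousAt fun q hq => ?_
  obtain ⟨hq1, -⟩ := mem_prod.1 hq
  have hσ : 0 < q.1 := hq1
  have ha : 0 < q.1 / 2 := by positivity
  -- the data `I(a)`, `a = q.1/2`, is bounded and continuous
  obtain ⟨-, hsI, -, ⟨D, hD⟩⟩ := gradDiv_heatExtension_smooth hgm hK ha
  obtain ⟨hD0, -, -⟩ := bounds_zero_one_two hD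
  have hmem : MemLp (gradient (VectorCalculus.divergence (heatExtension g (q.1 / 2)))) ∞ (volume : Measure E) :=
    memLp_top_of_bound hsI.continuous.aestronglyMeasurable (D 0) (Eventually.of_forall hD0)
  have hF : ContinuousOn (fun r : ℝ × E =>
      heatExtension (gradient (VectorCalculus.divergence (heatExtension g (q.1 / 2)))) (r.1 - q.1 / 2) r.2)
      (Ioi (q.1 / 2) ×ˢ univ) := by
    refine (continuousOn_uncurry_heatExtension_of_memLp hmem le_top).comp
      (f := fun r : ℝ × E => (r.1 - q.1 / 2, r.2)) (by fun_prop) fun r hr => ?_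
    obtain ⟨hr1, -⟩ := mem_prod.1 hr
    exact mk_mem_prod (show 0 < r.1 - q.1 / 2 from sub_pos.2 hr1) (mem_univ _)
  have hU : Ioi (q.1 / 2) ×ˢ (univ : Set E) ∈ 𝓝 q := by
    refine (isOpen_Ioi.prod isOpen_univ).mem_nhds (mk_mem_prod ?_ (mem_univ _))
    show q.1 / 2 < q.1; linarith
  have hFq : ContinuousAt (fun r : ℝ × E =>
      heatExtension (gradient (VectorCalculus.divergence (heatExtension g (q.1 / 2)))) (r.1 - q.1 / 2) r.2) q :=
    hF.continuousAt hU
  refine hFq.congr (Filter.eventuallyEq_of_mem hU fun r hr => ?_)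
  obtain ⟨hr1, -⟩ := mem_prod.1 hr
  exact (congrFun (gradDiv_heatExtension_eq_of_lt hgm hK ha hr1) r.2).symm

/-- **Joint continuity of `(σ, x) ↦ div e^{σΔ}g (x)` on `(0,∞) × E`**. [folklore] -/
theorem continuousOn_divergence_heatExtension_uncurry (hgm : AEStronglyMeasurable g volume) {K : ℝ}
    (hK : ∀ z, ‖g z‖ ≤ K) :
    ContinuousOn (fun q : ℝ × E => VectorCalculus.divergence (heatExtension g q.1) q.2)
      (Ioi (0 : ℝ) ×ˢ univ) := by
  haveI : CompleteSpace E := FiniteDimensional.complete ℝ E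
  refine continuousOn_of_forall_continuousAt fun q hq => ?_
  obtain ⟨hq1, -⟩ := mem_prod.1 hq
  have hσ : 0 < q.1 := hq1
  have ha : 0 < q.1 / 2 := by positivity
  obtain ⟨hsd, -, ⟨D, hD⟩, -⟩ := gradDiv_heatExtension_smooth hgm hK ha
  obtain ⟨hD0, -, -⟩ := bounds_zero_one_two hD
  have hmem : MemLp (VectorCalculus.divergence (heatExtension g (q.1 / 2))) ∞ (volume : Measure E) :=
    memLp_top_of_bound hsd.continuous.aestronglyMeasurable (D 0) (Eventually.of_forall hD0)
  have hF : ContinuousOn (fun r : ℝ × E =>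
      heatExtension (VectorCalculus.divergence (heatExtension g (q.1 / 2))) (r.1 - q.1 / 2) r.2)
      (Ioi (q.1 / 2) ×ˢ univ) := by
    refine (continuousOn_uncurry_heatExtension_of_memLp hmem le_top).comp
      (f := fun r : ℝ × E => (r.1 - q.1 / 2, r.2)) (by fun_prop) fun r hr => ?_
    obtain ⟨hr1, -⟩ := mem_prod.1 hr
    exact mk_mem_prod (show 0 < r.1 - q.1 / 2 from sub_pos.2 hr1) (mem_univ _)
  have hU : Ioi (q.1 / 2) ×ˢ (univ : Set E) ∈ 𝓝 q := by
    refine (isOpen_Ioi.prod isOpen_univ).mem_nhds (mk_mem_prod ?_ (mem_univ _))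
    show q.1 / 2 < q.1; linarith
  refine (hF.continuousAt hU).congr (Filter.eventuallyEq_of_mem hU fun r hr => ?_)
  obtain ⟨hr1, -⟩ := mem_prod.1 hr
  exact (congrFun (divergence_heatExtension_eq_of_lt hgm hK ha hr1) r.2).symm

/-- Continuity of `σ ↦ ∇div e^{σΔ}g (x)` on `(0, ∞)` for each `x`. [folklore] -/
theorem continuousOn_gradDiv_heatExtension_time (hgm : AEStronglyMeasurable g volume) {K : ℝ}
    (hK : ∀ z, ‖g z‖ ≤ K) (x : E) :
    ContinuousOn (fun σ : ℝ => gradient (VectorCalculus.divergence (heatExtension g σ)) x) (Ioi 0) :=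
  (continuousOn_gradDiv_heatExtension_uncurry hgm hK).comp (f := fun σ : ℝ => ((σ, x) : ℝ × E))
    (Continuous.prodMk_left x).continuousOn fun _ hσ => mk_mem_prod hσ (mem_univ x)

/-- Continuity of `σ ↦ div e^{σΔ}g (x)` on `(0, ∞)` for each `x`. [folklore] -/
theorem continuousOn_divergence_heatExtension_time (hgm : AEStronglyMeasurable g volume) {K : ℝ}
    (hK : ∀ z, ‖g z‖ ≤ K) (x : E) :
    ContinuousOn (fun σ : ℝ => VectorCalculus.divergence (heatExtension g σ) x) (Ioi 0) :=
  (continuousOn_divergence_heatExtension_uncurry hgm hK).comp (f := fun σ : ℝ => ((σ, x) : ℝ × E))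
    (Continuous.prodMk_left x).continuousOn fun _ hσ => mk_mem_prod hσ (mem_univ x)

/-- **Linearity of `div e^{σΔ}`** on bounded measurable data:
`div e^{σΔ}(g₁ + g₂) = div e^{σΔ}g₁ + div e^{σΔ}g₂`. [folklore] -/
theorem divergence_heatExtension_add {g₁ g₂ : E → E} (h₁ : AEStronglyMeasurable g₁ volume)
    (h₂ : AEStronglyMeasurable g₂ volume) {K₁ K₂ : ℝ} (hK₁ : ∀ z, ‖g₁ z‖ ≤ K₁) (hK₂ : ∀ z, ‖g₂ z‖ ≤ K₂)
    {σ : ℝ} (hσ : 0 < σ) (x : E) :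
    VectorCalculus.divergence (heatExtension (g₁ + g₂) σ) x =
      VectorCalculus.divergence (heatExtension g₁ σ) x + VectorCalculus.divergence (heatExtension g₂ σ) x := by
  haveI : CompleteSpace E := FiniteDimensional.complete ℝ E
  have hm₁ : MemLp g₁ ∞ (volume : Measure E) := memLp_top_of_bound h₁ K₁ (Eventually.of_forall hK₁)
  have hm₂ : MemLp g₂ ∞ (volume : Measure E) := memLp_top_of_bound h₂ K₂ (Eventually.of_forall hK₂)
  have hfun : heatExtension (g₁ + g₂) σ = fun y => heatExtension g₁ σ y + heatExtension g₂ σ y := by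
    funext y
    exact heatExtension_add_apply_of_memLp' hm₁ hm₂ le_top hσ y
  have hd₁ : DifferentiableAt ℝ (heatExtension g₁ σ) x :=
    ((contDiff_heatExtension_holds hm₁ le_top hσ).differentiable (by simp)) x
  have hd₂ : DifferentiableAt ℝ (heatExtension g₂ σ) x :=
    ((contDiff_heatExtension_holds hm₂ le_top hσ).differentiable (by simp)) x
  rw [hfun, divergence_add_apply hd₁ hd₂]

/-- **The divergence-free sum**: if `g₁ + g₂` is weakly divergence free (bounded measurable
summands), then `∇div e^{σΔ}g₁ = -∇div e^{σΔ}g₂` (`e^{σΔ}(g₁+g₂)` is divergence free, so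
`div e^{σΔ}g₁ = -div e^{σΔ}g₂`). [folklore] -/
theorem gradDiv_heatExtension_eq_neg_of_isWeaklyDivFree_add {g₁ g₂ : E → E}
    (h₁ : AEStronglyMeasurable g₁ volume) (h₂ : AEStronglyMeasurable g₂ volume) {K₁ K₂ : ℝ}
    (hK₁ : ∀ z, ‖g₁ z‖ ≤ K₁) (hK₂ : ∀ z, ‖g₂ z‖ ≤ K₂) (hdiv : IsWeaklyDivFree (g₁ + g₂))
    {σ : ℝ} (hσ : 0 < σ) :
    gradient (VectorCalculus.divergence (heatExtension g₁ σ)) =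
      -gradient (VectorCalculus.divergence (heatExtension g₂ σ)) := by
  haveI : CompleteSpace E := FiniteDimensional.complete ℝ E
  have hm : MemLp (g₁ + g₂) ∞ (volume : Measure E) :=
    memLp_top_of_bound (h₁.add h₂) (K₁ + K₂) (Eventually.of_forall fun z =>
      (norm_add_le _ _).trans (add_le_add (hK₁ z) (hK₂ z)))
  -- `e^{σΔ}(g₁ + g₂)` is divergence free
  have hwdf : IsWeaklyDivFree (heatExtension (g₁ + g₂) σ) :=
    isWeaklyDivFree_heatExtension hdiv (MemLp.isPolynomiallyTempered le_top hm) hσ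
  have hdf : VectorCalculus.IsDivFree (heatExtension (g₁ + g₂) σ) :=
    hwdf.isDivFree_of_contDiff (contDiff_infty.1 (contDiff_heatExtension_holds hm le_top hσ) 1)
  have hfun : VectorCalculus.divergence (heatExtension g₁ σ) =
      -VectorCalculus.divergence (heatExtension g₂ σ) := by
    funext x
    have h := hdf x
    rw [divergence_heatExtension_add h₁ h₂ hK₁ hK₂ hσ x] at h
    simpa [Pi.neg_apply] using eq_neg_of_add_eq_zero_left h
  rw [hfun]
  funext x
  simp only [Pi.neg_apply, gradient, fderiv_neg, map_neg]

end Time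

end Literature.Analysis.FluidPDE

end
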